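import Summits.ValiantsHypothesis.ValiantsHypothesis.Theorems.KPlusLogSqLawTropicalBThreeFiveRepeated
import Summits.ValiantsHypothesis.ValiantsHypothesis.Theorems.KPlusLogSqLawTropicalBThreeFiveThirtyTwo

/-!
# Route «KPlusLogSqLaw», crux `TropicalB` (stmt-ValiantsHypothesis-19771) — `(3,5)` row: the ROOT GLUE of the programme «`T_D(3,5) = 31`»
# (generic exponent vectors ⇒ the whole row; exact-value packaging)

HONEST FRAMING.  Helper toward the registered stubs `stub_tropThin` / `stub_tropFat` of `Cruxes/TropicalB/Lines/birth.lean` (crux `TropicalB`,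
item stmt-ValiantsHypothesis-19771; cell `pub-symmetroid`, seat val-sym-trop-p3 g10, 2026-08-28; `--supports … --as helper`).  CONDITIONAL glue for
the small-format census value `T_D(3,5)` — it proves NOTHING new about the row by itself: the hypothesis `Generic31` (every design with STRICTLY
INCREASING exponents has unsigned chains of `≤ 31` breakpoints) is exactly what the leaf certificates of the programme (`…ThreeFiveCellA` is the first)
must cover by a decision tree over slope comparisons (memo HOME/val-sym-trop-p3/g10/PROGRAMME-T35-exact.md).  Located status: the two order-level
laws give `≤ 31` on every sampled exponent order type (this seat's sweep), i.e. `Generic31` is the located expectation; kernel: `31 ≤ T_D(3,5) ≤ 33`.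
Nothing here bears on `TropicalB` in its window, `WeakLifting`, DoorA26 / DoorA34, `MatrixDescartes` (stmt-ValiantsHypothesis-18050) or VP ≠ VNP.

CONTENT.  `Generic31` (the generic-exponent case, as a `Prop`-valued `def` would be a statement item — so it is spelled out as a hypothesis);
`tropRowD_three_five_31_of_generic : (∀ d, StrictMono d → ∀ v ε, DesignRowD d v ε 31) → TropRowD 3 5 31` (non-injective `d`:
`designRowD_le_31_of_not_injective`; injective `d`: sort the classes, `chain_relabel_classes`); `three_five_exact_of_generic` — with the kernel floor
`not_tropRowD_three_5_30` (`…ThreeFiveThirtyTwo`) the row value is then EXACTLY `31`.  [this cell]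
-/

set_option linter.dupNamespace false
set_option autoImplicit false

namespace Summit.ValiantsHypothesis.ValiantsHypothesis.Theorems.KPlusLogSqLaw

open Summit.ValiantsHypothesis.ValiantsHypothesis.Theorems.MatrixDescartes.Negative
open Summit.ValiantsHypothesis.ValiantsHypothesis.Theorems.LacunarySymmetroidMatrixDescartes.TropicalCensus
open Finset ForbiddenPatterns

namespace ThreeFive

/-- **ROOT GLUE**: if every `(3,5)` design with strictly increasing exponents has unsigned dominant chains of at most `31` breakpoints, then so does
every `(3,5)` design (`TropRowD 3 5 31`): repeated exponents give `≤ 19` (`designRowD_le_19_of_eq`), and an injective exponent vector is sorted by a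
class relabelling which preserves dominance and distinctness of consecutive terms. [this cell] -/
theorem tropRowD_three_five_31_of_generic
    (hgen : ∀ d : Fin 5 → ℕ, StrictMono d → ∀ v ε : Fin 3 → Fin 3 → Fin 5 → ℤ, DesignRowD d v ε 31) : TropRowD 3 5 31 := by
  intro d v ε n θ p hθ hdom hne
  by_cases hinj : Function.Injective d
  · set π : Equiv.Perm (Fin 5) := Tuple.sort d with hπ
    have hmono : Monotone (d ∘ π) := by rw [hπ]; exact Tuple.monotone_sort d
    have hsm : StrictMono (d ∘ π) := hmono.strictMono_of_injective (hinj.comp π.injective)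
    obtain ⟨hdom', -⟩ := chain_relabel_classes π d v ε θ p hdom
    have hne' : ∀ k : Fin n,
        ((p k.castSucc).1, π.symm ∘ (p k.castSucc).2) ≠ ((p k.succ).1, π.symm ∘ (p k.succ).2) := by
      intro k h
      apply hne k
      have h1 := congrArg Prod.fst h
      have h2 := congrArg Prod.snd h
      refine Prod.ext h1 ?_
      funext i
      exact π.symm.injective (congrFun h2 i)
    exact hgen (d ∘ π) hsm _ _ n θ (fun k => ((p k).1, π.symm ∘ (p k).2)) hθ hdom' hne'
  · exact designRowD_le_31_of_not_injective d hinj v ε n θ p hθ hdom hne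

/-- **EXACT VALUE, CONDITIONALLY**: under the same generic-exponent hypothesis the unsigned `(3,5)` row is EXACTLY `31`
(`¬ TropRowD 3 5 30` is the kernel floor `not_tropRowD_three_5_30` of `…ThreeFiveThirtyTwo`). [this cell] -/
theorem three_five_exact_of_generic
    (hgen : ∀ d : Fin 5 → ℕ, StrictMono d → ∀ v ε : Fin 3 → Fin 3 → Fin 5 → ℤ, DesignRowD d v ε 31) :
    ¬ TropRowD 3 5 30 ∧ TropRowD 3 5 31 :=
  ⟨not_tropRowD_three_5_30, tropRowD_three_five_31_of_generic hgen⟩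

end ThreeFive

end Summit.ValiantsHypothesis.ValiantsHypothesis.Theorems.KPlusLogSqLaw
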